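import Mathlib.MeasureTheory.Measure.Prod
import Literature.Probability.LatticeModels.GibbsSpecification
import HarnessLib

/-!
# Pair measures that are conditionally DLR in one copy: product structure from extremality

Helper file (`--supports stmt-QuantumFields-18156 --as helper`) for stub (RT) `stub_replicaDecoupling` of line `replica-rooting`
of crux `Summit.QuantumFields.YangMills.Theses.HyperbolicRegulator.HyperbolicToTorusR` (stmt-QuantumFields-18156); consumed by
`Theorems/HyperbolicRegulatorHyperbolicToTorusRStubReplicaDecoupling.lean`.  General specification `γ` on `V → S`
(tree `Literature.Probability.LatticeModels.Specification`, `gibbsMeasures`, `IsExtremalGibbs`); no lattice gauge theory here.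

* `eq_smul_of_add_eq_of_isExtremalGibbs` — if an extremal Gibbs measure `μ` of `γ` splits as `μ = ν₁ + ν₂` with both pieces
  satisfying the DLR identity `∫ γ_Λ(A|η) dνᵢ(η) = νᵢ(A)`, then `ν₁ = ν₁(Ω) • μ` (normalise the pieces when both are non-zero:
  `μ` lies in the open segment between two Gibbs measures; the degenerate cases are direct).
* For a measure `Q` on `Ω × Ω` that is CONDITIONALLY DLR in the second copy given the first —
  `∫ γ_Λ(E_{ω₁} | ω₂) dQ(ω₁, ω₂) = Q(E)` for measurable `E ⊆ Ω × Ω`, `E_{ω₁}` the slice — testing on the rectangle `s ×ˢ t`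
  shows that the piece `ν_s := (Q|_{fst⁻¹ s}) ∘ snd⁻¹`, `ν_s(t) = Q(s ×ˢ t)`, satisfies the DLR identity
  (`setLIntegral_fst_preimage_eq`, `piece_dlr`); with `s = Ω` the second marginal `Q₂` is a DLR state
  (`map_snd_mem_gibbsMeasures`).  If `Q₂` is extremal, `ν_s = Q₁(s) • Q₂`, i.e. `Q(s ×ˢ t) = Q₁(s) Q₂(t)`
  (`measure_prod_eq_mul_of_isExtremalGibbs`), so `Q = Q₁ ⊗ Q₂` (`prod_map_eq_of_isExtremalGibbs`, Mathlib `Measure.prod_eq`).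

This is the disintegration-free form of "the fibres of `Q` over `ω₁` are DLR a.s., and an extremal state has a Dirac
representing measure" (Georgii 2011, Thm. 7.7; Friedli–Velenik 2017, §6.8); elementary measure theory, no named fact consumed.
-/

noncomputable section

open scoped ENNReal
open Set MeasureTheory
open Literature.Probability.LatticeModels (IsExtremalGibbs Specification IsGibbsMeasure gibbsMeasures)

namespace Summit.QuantumFields.YangMills.Theorems.HyperbolicToTorusR

/-! ## An extremal Gibbs measure split into two DLR pieces is proportional to each piece -/

section Extremal

variable {V S : Type*} [MeasurableSpace S] {γ : Specification V S}

/-- **Two-piece mixtures of an extremal Gibbs measure are trivial.**  If `μ` is an extremal Gibbs measure of the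
specification `γ` and `μ = ν₁ + ν₂` with both pieces satisfying the DLR identity
`∫ γ_Λ(A | η) dνᵢ(η) = νᵢ(A)`, then `ν₁ = ν₁(Ω) • μ` (Georgii 2011, Thm. 7.7 (a), the trivial direction). [folklore] -/
theorem eq_smul_of_add_eq_of_isExtremalGibbs {μ ν₁ ν₂ : Measure (V → S)} (hμ : IsExtremalGibbs γ μ)
    (hsum : ν₁ + ν₂ = μ)
    (h₁ : ∀ (Λ : Finset V) (A : Set (V → S)), MeasurableSet A → ∫⁻ η, γ Λ η A ∂ν₁ = ν₁ A)
    (h₂ : ∀ (Λ : Finset V) (A : Set (V → S)), MeasurableSet A → ∫⁻ η, γ Λ η A ∂ν₂ = ν₂ A) :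
    ν₁ = ν₁ Set.univ • μ := by
  have hμ' : μ ∈ Set.extremePoints ℝ≥0∞ (gibbsMeasures γ) := hμ
  obtain ⟨hμG, hext⟩ := mem_extremePoints.1 hμ'
  haveI : IsProbabilityMeasure μ := IsGibbsMeasure.isProbabilityMeasure hμG
  have htot : ν₁ univ + ν₂ univ = 1 := by rw [← Measure.add_apply, hsum, measure_univ]
  by_cases h0 : ν₁ univ = 0
  · rw [h0, zero_smul]
    exact Measure.measure_univ_eq_zero.1 h0
  by_cases h0' : ν₂ univ = 0
  · have hν₂ : ν₂ = 0 := Measure.measure_univ_eq_zero.1 h0'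
    rw [hν₂, add_zero] at hsum
    rw [hν₂, Measure.coe_zero, Pi.zero_apply, add_zero] at htot
    rw [htot, one_smul]
    exact hsum
  -- both pieces are non-trivial: normalise them to Gibbs measures
  have key : ∀ {κ : Measure (V → S)}, κ univ ≠ 0 → κ univ ≠ ∞ →
      (∀ (Λ : Finset V) (A : Set (V → S)), MeasurableSet A → ∫⁻ η, γ Λ η A ∂κ = κ A) →
        (κ univ)⁻¹ • κ ∈ gibbsMeasures γ := by
    intro κ hκ0 hκt hκ
    refine ⟨⟨?_⟩, fun Λ A hA => ?_⟩
    · rw [Measure.smul_apply, smul_eq_mul, ENNReal.inv_mul_cancel hκ0 hκt]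
    · rw [lintegral_smul_measure, hκ Λ A hA, Measure.smul_apply]
  have h1t : ν₁ univ ≠ ∞ := ne_top_of_le_ne_top ENNReal.one_ne_top (le_self_add.trans_eq htot)
  have h2t : ν₂ univ ≠ ∞ := ne_top_of_le_ne_top ENNReal.one_ne_top (le_add_self.trans_eq htot)
  have hseg : μ ∈ openSegment ℝ≥0∞ ((ν₁ univ)⁻¹ • ν₁) ((ν₂ univ)⁻¹ • ν₂) :=
    ⟨ν₁ univ, ν₂ univ, pos_iff_ne_zero.2 h0, pos_iff_ne_zero.2 h0', htot, by
      rw [smul_smul, smul_smul, ENNReal.mul_inv_cancel h0 h1t, ENNReal.mul_inv_cancel h0' h2t, one_smul,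
        one_smul, hsum]⟩
  have hμ₁ : (ν₁ univ)⁻¹ • ν₁ = μ := (hext _ (key h0 h1t h₁) _ (key h0' h2t h₂) hseg).1
  calc ν₁ = ν₁ univ • ((ν₁ univ)⁻¹ • ν₁) := by
        rw [smul_smul, ENNReal.mul_inv_cancel h0 h1t, one_smul]
    _ = ν₁ univ • μ := by rw [hμ₁]

end Extremal

/-! ## Pair measures that are conditionally DLR in the second copy -/

section PairState

variable {V S : Type*} [MeasurableSpace S] {γ : Specification V S} {Q : Measure ((V → S) × (V → S))}

/-- Conditional DLR in the second copy, tested on a rectangle `s ×ˢ t`: the slice of `s ×ˢ t` at `ω₁` is `t` or `∅`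
according as `ω₁ ∈ s` or not, so `∫_{ω₁ ∈ s} γ_Λ(t | ω₂) dQ = Q(s ×ˢ t)`. [folklore] -/
theorem setLIntegral_fst_preimage_eq
    (hDLR : ∀ (Λ : Finset V) (E : Set ((V → S) × (V → S))), MeasurableSet E →
      ∫⁻ p, γ Λ p.2 ((fun ζ => (p.1, ζ)) ⁻¹' E) ∂Q = Q E)
    (Λ : Finset V) {s t : Set (V → S)} (hs : MeasurableSet s) (ht : MeasurableSet t) :
    ∫⁻ p in Prod.fst ⁻¹' s, γ Λ p.2 t ∂Q = Q (s ×ˢ t) := by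
  rw [← hDLR Λ (s ×ˢ t) (hs.prod ht), ← lintegral_indicator (measurable_fst hs)]
  refine lintegral_congr fun p => ?_
  by_cases hp : p.1 ∈ s
  · rw [indicator_of_mem (show p ∈ Prod.fst ⁻¹' s from hp)]
    show γ Λ p.2 t = γ Λ p.2 (Prod.mk p.1 ⁻¹' s ×ˢ t)
    rw [Set.mk_preimage_prod_right hp]
  · rw [indicator_of_notMem (show p ∉ Prod.fst ⁻¹' s from hp)]
    show (0 : ℝ≥0∞) = γ Λ p.2 (Prod.mk p.1 ⁻¹' s ×ˢ t)
    rw [Set.mk_preimage_prod_right_eq_empty hp, measure_empty]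

/-- The piece `ν_s = (Q|_{fst⁻¹ s}) ∘ snd⁻¹` of the second marginal over a measurable set `s` of first coordinates
satisfies the DLR identity `∫ γ_Λ(t | η) dν_s(η) = ν_s(t)`. [folklore] -/
theorem piece_dlr
    (hγm : ∀ (Λ : Finset V) (A : Set (V → S)), MeasurableSet A → Measurable fun η => γ Λ η A)
    (hDLR : ∀ (Λ : Finset V) (E : Set ((V → S) × (V → S))), MeasurableSet E →
      ∫⁻ p, γ Λ p.2 ((fun ζ => (p.1, ζ)) ⁻¹' E) ∂Q = Q E)
    {s : Set (V → S)} (hs : MeasurableSet s) (Λ : Finset V) {t : Set (V → S)} (ht : MeasurableSet t) :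
    ∫⁻ η, γ Λ η t ∂((Q.restrict (Prod.fst ⁻¹' s)).map Prod.snd) =
      (Q.restrict (Prod.fst ⁻¹' s)).map Prod.snd t := by
  rw [lintegral_map (hγm Λ t ht) measurable_snd, Measure.map_apply measurable_snd ht,
    Measure.restrict_apply (measurable_snd ht), setLIntegral_fst_preimage_eq hDLR Λ hs ht, Set.prod_eq,
    Set.inter_comm]

/-- The second marginal of a probability measure that is conditionally DLR in the second copy is a DLR state.
[folklore] -/
theorem map_snd_mem_gibbsMeasures [IsProbabilityMeasure Q]
    (hγm : ∀ (Λ : Finset V) (A : Set (V → S)), MeasurableSet A → Measurable fun η => γ Λ η A)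
    (hDLR : ∀ (Λ : Finset V) (E : Set ((V → S) × (V → S))), MeasurableSet E →
      ∫⁻ p, γ Λ p.2 ((fun ζ => (p.1, ζ)) ⁻¹' E) ∂Q = Q E) :
    Q.map Prod.snd ∈ gibbsMeasures γ := by
  refine ⟨Measure.isProbabilityMeasure_map measurable_snd.aemeasurable, fun Λ t ht => ?_⟩
  have h := piece_dlr hγm hDLR MeasurableSet.univ Λ ht
  rwa [Set.preimage_univ, Measure.restrict_univ] at h

/-- **Rectangles factorise** when the second marginal is extremal: `Q(s ×ˢ t) = Q₁(s) Q₂(t)` — the pieces over `s`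
and `sᶜ` are DLR and sum to `Q₂`, so each is proportional to `Q₂`. [folklore] -/
theorem measure_prod_eq_mul_of_isExtremalGibbs
    (hγm : ∀ (Λ : Finset V) (A : Set (V → S)), MeasurableSet A → Measurable fun η => γ Λ η A)
    (hDLR : ∀ (Λ : Finset V) (E : Set ((V → S) × (V → S))), MeasurableSet E →
      ∫⁻ p, γ Λ p.2 ((fun ζ => (p.1, ζ)) ⁻¹' E) ∂Q = Q E)
    (hext : IsExtremalGibbs γ (Q.map Prod.snd)) {s t : Set (V → S)} (hs : MeasurableSet s)
    (ht : MeasurableSet t) : Q (s ×ˢ t) = Q.map Prod.fst s * Q.map Prod.snd t := by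
  have hsum : (Q.restrict (Prod.fst ⁻¹' s)).map Prod.snd + (Q.restrict (Prod.fst ⁻¹' sᶜ)).map Prod.snd =
      Q.map Prod.snd := by
    rw [← Measure.map_add _ _ measurable_snd, Set.preimage_compl,
      Measure.restrict_add_restrict_compl (measurable_fst hs)]
  have key := eq_smul_of_add_eq_of_isExtremalGibbs hext hsum (fun Λ' A hA => piece_dlr hγm hDLR hs Λ' hA)
    (fun Λ' A hA => piece_dlr hγm hDLR hs.compl Λ' hA)
  have h1 : (Q.restrict (Prod.fst ⁻¹' s)).map Prod.snd t = Q (s ×ˢ t) := by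
    rw [Measure.map_apply measurable_snd ht, Measure.restrict_apply (measurable_snd ht), Set.prod_eq,
      Set.inter_comm]
  have h2 : (Q.restrict (Prod.fst ⁻¹' s)).map Prod.snd univ = Q.map Prod.fst s := by
    rw [Measure.map_apply measurable_snd MeasurableSet.univ,
      Measure.restrict_apply (measurable_snd MeasurableSet.univ), Set.preimage_univ, Set.univ_inter,
      Measure.map_apply measurable_fst hs]
  rw [← h1, key, Measure.smul_apply, smul_eq_mul, h2]

/-- **Product structure.**  A probability measure on `Ω × Ω` that is conditionally DLR in the second copy and whose
second marginal is an extremal Gibbs measure is the product of its marginals. [folklore] -/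
theorem prod_map_eq_of_isExtremalGibbs [IsProbabilityMeasure Q]
    (hγm : ∀ (Λ : Finset V) (A : Set (V → S)), MeasurableSet A → Measurable fun η => γ Λ η A)
    (hDLR : ∀ (Λ : Finset V) (E : Set ((V → S) × (V → S))), MeasurableSet E →
      ∫⁻ p, γ Λ p.2 ((fun ζ => (p.1, ζ)) ⁻¹' E) ∂Q = Q E)
    (hext : IsExtremalGibbs γ (Q.map Prod.snd)) : (Q.map Prod.fst).prod (Q.map Prod.snd) = Q := by
  haveI := Measure.isProbabilityMeasure_map (μ := Q) measurable_fst.aemeasurable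
  haveI := Measure.isProbabilityMeasure_map (μ := Q) measurable_snd.aemeasurable
  exact Measure.prod_eq fun s t hs ht => measure_prod_eq_mul_of_isExtremalGibbs hγm hDLR hext hs ht

end PairState

end Summit.QuantumFields.YangMills.Theorems.HyperbolicToTorusR

end
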